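import Mathlib
import HarnessLib
import Summits.AtomisticToContinuum.BoseEinsteinCondensation.Theses.GapWindowLadder
import Summits.AtomisticToContinuum.BoseEinsteinCondensation.Theorems.GapWindowLadderFreeWindowParseval
import Summits.AtomisticToContinuum.BoseEinsteinCondensation.Theorems.NumberPhaseSandwichLossBookkeeping

/-!
# GapWindowLadder — the free-case door `GapWindowResponseFree` (stmt-AtomisticToContinuum-28031), part 4/4: THE LAW, BY NAME

Route `route-AtomisticToContinuum-GapWindowLadder`, split gen 1 of the declared residual `GapWindowResponse`
(stmt-AtomisticToContinuum-27583) into `GapWindowResponseFree` (zero scattering length, THIS theorem) and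
`GapWindowResponsePos` (positive scattering length, the residual); glue `FreeExcisionGlue` landed as
`GapWindowLadderFreeExcisionGlue.freeExcisionGlue`. decomp-a2c lens-6 g14.

The whole argument is told in the module docstring of part 1 (`GapWindowLadderFreeWindowModes`).
This part: (10b) the slice law `Σ_P Σ_{c,c'} ℓ⁻³|J_c − J_{c'}|² ≤ 20·G_k·|c(Y)|² + 160 ∫|r_Y|²`, the gap step
`3(π/L)²·N·∫∫|r_Y|² ≤ E − E₀(0,N,L)`, (11) the law for one state, the free body (`κ = 1`, `e(K,k) = e(k)`), and
`gapWindowResponseFree : …Theses.GapWindowLadder.GapWindowResponseFree` BY NAME (`ρ₀ = 1`).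
(`NumberPhaseSandwichLossBookkeeping` is imported for the slice / dipole-occupation toolkit `J`, `occupation_dip_eq`,
`sibling_sum_eq`, exactly as `GapWindowLadderLossBookkeeping` already does.)
-/

noncomputable section

namespace Summit.AtomisticToContinuum.BoseEinsteinCondensation.Theorems.GapWindowLadderFreeWindow

open scoped BigOperators Topology ENNReal NNReal ComplexConjugate
open Filter MeasureTheory Set
open Literature.MathematicalPhysics.QuantumManyBody.BoseGas
open Literature.MathematicalPhysics.QuantumManyBody.NeumannBox
open Literature.MathematicalPhysics.QuantumManyBody.DirichletBox
open Summit.AtomisticToContinuum.BoseEinsteinCondensation.Theorems.NumberPhaseSandwichLossBookkeeping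
open Summit.AtomisticToContinuum.BoseEinsteinCondensation.Theorems.NumberPhaseSandwichLossBookkeepingCells
open Summit.AtomisticToContinuum.BoseEinsteinCondensation.Theorems.GapWindowLadderFreeWindowModes
open Summit.AtomisticToContinuum.BoseEinsteinCondensation.Theorems.GapWindowLadderFreeWindowCells
open Summit.AtomisticToContinuum.BoseEinsteinCondensation.Theorems.GapWindowLadderFreeWindowParseval

/-! ## 10b. The slice law and the gap step -/

section Law

variable {n : ℕ} {L : ℝ}

/-- **The slice law**: for every slice `Y`, with `α = ⟨s, Φ(·,Y)⟩` and `r = Φ(·,Y) − α s`,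
`Σ_P Σ_{c,c'} ℓ⁻³|J_c − J_{c'}|² ≤ 20 G_k |α|² + 160 ∫|r|²`. -/
theorem sliceLaw (hL : 0 < L) {k : ℕ} (hk : 1 ≤ k) (Φ : TrialState (n + 1) L) (Y : Config n) :
    ∑ P : SubIdx (2 ^ (k - 1)), ∑ c ∈ children P, ∑ c' ∈ children P,
        (ENNReal.ofReal (L / 2 ^ k) ^ 3)⁻¹ *
          ‖J Φ.ψ (subCell (L / 2 ^ k) c) Y - J Φ.ψ (subCell (L / 2 ^ k) c') Y‖ₑ ^ 2 ≤
      ENNReal.ofReal (5 / 4) * ‖∫ x, conj (sineMode L x) * Φ.ψ (Matrix.vecCons x Y)‖ₑ ^ 2 *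
          (16 * ENNReal.ofReal (Greal L k)) +
        160 * ∫⁻ x, ‖Φ.ψ (Matrix.vecCons x Y) -
          (∫ x, conj (sineMode L x) * Φ.ψ (Matrix.vecCons x Y)) * sineMode L x‖ₑ ^ 2 := by
  set ℓ := L / 2 ^ k with hℓdef
  have hℓ : 0 < ℓ := by positivity
  set α : ℂ := ∫ x, conj (sineMode L x) * Φ.ψ (Matrix.vecCons x Y) with hαdef
  set r : Space → ℂ := fun x => Φ.ψ (Matrix.vecCons x Y) - α * sineMode L x with hrdef
  have hr_meas : AEStronglyMeasurable r volume :=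
    ((continuous_slice Φ.contDiff.continuous Y).aestronglyMeasurable).sub
      ((aestronglyMeasurable_sineMode L).const_mul α)
  -- `R_c = J_c − α a_c`
  have hR : ∀ c : SubIdx (2 ^ k), ∫ x in subCell ℓ c, r x = J Φ.ψ (subCell ℓ c) Y - α * cellMass L k c := by
    intro c
    simp only [hrdef]
    rw [integral_sub (integrable_slice Φ Y).integrableOn ((integrable_sineMode L).const_mul α).integrableOn,
      MeasureTheory.integral_const_mul]
    rfl
  -- pointwise Young
  have hpt : ∀ c c' : SubIdx (2 ^ k),
      (ENNReal.ofReal ℓ ^ 3)⁻¹ * ‖J Φ.ψ (subCell ℓ c) Y - J Φ.ψ (subCell ℓ c') Y‖ₑ ^ 2 ≤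
        (ENNReal.ofReal ℓ ^ 3)⁻¹ * (ENNReal.ofReal (5 / 4) * (‖α‖ₑ ^ 2 * ‖cellMass L k c - cellMass L k c'‖ₑ ^ 2)) +
          (ENNReal.ofReal ℓ ^ 3)⁻¹ * (10 * ‖∫ x in subCell ℓ c, r x‖ₑ ^ 2) +
          (ENNReal.ofReal ℓ ^ 3)⁻¹ * (10 * ‖∫ x in subCell ℓ c', r x‖ₑ ^ 2) := by
    intro c c'
    rw [← mul_add, ← mul_add, hR c, hR c']
    gcongr
    exact enorm_sub_sq_le_young _ _ α (cellMass L k c) (cellMass L k c')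
  -- the residual sums
  have hres : ∑ c : SubIdx (2 ^ k), (ENNReal.ofReal ℓ ^ 3)⁻¹ * ‖∫ x in subCell ℓ c, r x‖ₑ ^ 2 ≤
      ∫⁻ x, ‖r x‖ₑ ^ 2 := sum_inv_vol_mul_enorm_setIntegral_sq_le hℓ hr_meas
  have h2 : ∑ P : SubIdx (2 ^ (k - 1)), ∑ c ∈ children P, ∑ c' ∈ children P,
      (ENNReal.ofReal ℓ ^ 3)⁻¹ * (10 * ‖∫ x in subCell ℓ c, r x‖ₑ ^ 2) ≤ 80 * ∫⁻ x, ‖r x‖ₑ ^ 2 := by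
    have h : ∀ P : SubIdx (2 ^ (k - 1)), ∑ c ∈ children P, ∑ c' ∈ children P,
        (ENNReal.ofReal ℓ ^ 3)⁻¹ * (10 * ‖∫ x in subCell ℓ c, r x‖ₑ ^ 2) =
          8 * ∑ c ∈ children P, (ENNReal.ofReal ℓ ^ 3)⁻¹ * (10 * ‖∫ x in subCell ℓ c, r x‖ₑ ^ 2) :=
      fun P => sum_children_pair_left hk P _
    simp_rw [h]
    rw [← Finset.mul_sum, ← sum_eq_sum_children (fun c => (ENNReal.ofReal ℓ ^ 3)⁻¹ * (10 * ‖∫ x in subCell ℓ c, r x‖ₑ ^ 2))]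
    have h' : ∑ c : SubIdx (2 ^ k), (ENNReal.ofReal ℓ ^ 3)⁻¹ * (10 * ‖∫ x in subCell ℓ c, r x‖ₑ ^ 2) =
        10 * ∑ c : SubIdx (2 ^ k), (ENNReal.ofReal ℓ ^ 3)⁻¹ * ‖∫ x in subCell ℓ c, r x‖ₑ ^ 2 := by
      rw [Finset.mul_sum]
      refine Finset.sum_congr rfl fun c _ => ?_
      ring
    rw [h', ← mul_assoc, show (8 : ℝ≥0∞) * 10 = 80 by norm_num]
    gcongr
  have h3 : ∑ P : SubIdx (2 ^ (k - 1)), ∑ c ∈ children P, ∑ c' ∈ children P,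
      (ENNReal.ofReal ℓ ^ 3)⁻¹ * (10 * ‖∫ x in subCell ℓ c', r x‖ₑ ^ 2) ≤ 80 * ∫⁻ x, ‖r x‖ₑ ^ 2 := by
    have h : ∀ P : SubIdx (2 ^ (k - 1)), ∑ c ∈ children P, ∑ c' ∈ children P,
        (ENNReal.ofReal ℓ ^ 3)⁻¹ * (10 * ‖∫ x in subCell ℓ c', r x‖ₑ ^ 2) =
          8 * ∑ c' ∈ children P, (ENNReal.ofReal ℓ ^ 3)⁻¹ * (10 * ‖∫ x in subCell ℓ c', r x‖ₑ ^ 2) :=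
      fun P => sum_children_pair_right hk P _
    simp_rw [h]
    rw [← Finset.mul_sum, ← sum_eq_sum_children (fun c => (ENNReal.ofReal ℓ ^ 3)⁻¹ * (10 * ‖∫ x in subCell ℓ c, r x‖ₑ ^ 2))]
    have h' : ∑ c : SubIdx (2 ^ k), (ENNReal.ofReal ℓ ^ 3)⁻¹ * (10 * ‖∫ x in subCell ℓ c, r x‖ₑ ^ 2) =
        10 * ∑ c : SubIdx (2 ^ k), (ENNReal.ofReal ℓ ^ 3)⁻¹ * ‖∫ x in subCell ℓ c, r x‖ₑ ^ 2 := by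
      rw [Finset.mul_sum]
      refine Finset.sum_congr rfl fun c _ => ?_
      ring
    rw [h', ← mul_assoc, show (8 : ℝ≥0∞) * 10 = 80 by norm_num]
    gcongr
  -- the coherent sum
  have h1 : ∑ P : SubIdx (2 ^ (k - 1)), ∑ c ∈ children P, ∑ c' ∈ children P,
      (ENNReal.ofReal ℓ ^ 3)⁻¹ * (ENNReal.ofReal (5 / 4) * (‖α‖ₑ ^ 2 * ‖cellMass L k c - cellMass L k c'‖ₑ ^ 2)) =
        ENNReal.ofReal (5 / 4) * ‖α‖ₑ ^ 2 * (16 * ENNReal.ofReal (Greal L k)) := by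
    rw [← sum_cellMass_pair_eq hL k, Finset.mul_sum]
    refine Finset.sum_congr rfl fun P _ => ?_
    rw [Finset.mul_sum]
    refine Finset.sum_congr rfl fun c _ => ?_
    rw [Finset.mul_sum]
    refine Finset.sum_congr rfl fun c' _ => ?_
    ring
  calc ∑ P : SubIdx (2 ^ (k - 1)), ∑ c ∈ children P, ∑ c' ∈ children P,
        (ENNReal.ofReal ℓ ^ 3)⁻¹ * ‖J Φ.ψ (subCell ℓ c) Y - J Φ.ψ (subCell ℓ c') Y‖ₑ ^ 2
      ≤ ∑ P : SubIdx (2 ^ (k - 1)), ∑ c ∈ children P, ∑ c' ∈ children P,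
          ((ENNReal.ofReal ℓ ^ 3)⁻¹ * (ENNReal.ofReal (5 / 4) * (‖α‖ₑ ^ 2 * ‖cellMass L k c - cellMass L k c'‖ₑ ^ 2)) +
            (ENNReal.ofReal ℓ ^ 3)⁻¹ * (10 * ‖∫ x in subCell ℓ c, r x‖ₑ ^ 2) +
            (ENNReal.ofReal ℓ ^ 3)⁻¹ * (10 * ‖∫ x in subCell ℓ c', r x‖ₑ ^ 2)) := by
        gcongr with P _ c _ c' _
        exact hpt c c'
    _ = (∑ P : SubIdx (2 ^ (k - 1)), ∑ c ∈ children P, ∑ c' ∈ children P,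
          (ENNReal.ofReal ℓ ^ 3)⁻¹ * (ENNReal.ofReal (5 / 4) * (‖α‖ₑ ^ 2 * ‖cellMass L k c - cellMass L k c'‖ₑ ^ 2))) +
        (∑ P : SubIdx (2 ^ (k - 1)), ∑ c ∈ children P, ∑ c' ∈ children P,
          (ENNReal.ofReal ℓ ^ 3)⁻¹ * (10 * ‖∫ x in subCell ℓ c, r x‖ₑ ^ 2)) +
        (∑ P : SubIdx (2 ^ (k - 1)), ∑ c ∈ children P, ∑ c' ∈ children P,
          (ENNReal.ofReal ℓ ^ 3)⁻¹ * (10 * ‖∫ x in subCell ℓ c', r x‖ₑ ^ 2)) := by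
        simp_rw [Finset.sum_add_distrib]
    _ ≤ ENNReal.ofReal (5 / 4) * ‖α‖ₑ ^ 2 * (16 * ENNReal.ofReal (Greal L k)) +
          80 * (∫⁻ x, ‖r x‖ₑ ^ 2) + 80 * ∫⁻ x, ‖r x‖ₑ ^ 2 := by
        rw [h1]
        gcongr
    _ = _ := by
        rw [add_assoc, ← add_mul, show (80 : ℝ≥0∞) + 80 = 160 by norm_num]

/-- slices of a trial state are square integrable. -/
theorem lintegral_slice_sq_ne_top (Φ : TrialState (n + 1) L) (Y : Config n) :
    ∫⁻ x, ‖Φ.ψ (Matrix.vecCons x Y)‖ₑ ^ 2 ≠ ⊤ := by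
  have hc : Continuous fun x => Φ.ψ (Matrix.vecCons x Y) := continuous_slice Φ.contDiff.continuous Y
  have hcs : HasCompactSupport fun x => Φ.ψ (Matrix.vecCons x Y) := hasCompactSupport_slice Φ Y
  have hsupp : Function.support (fun x => ‖Φ.ψ (Matrix.vecCons x Y)‖ ^ 2) ⊆
      Function.support fun x => Φ.ψ (Matrix.vecCons x Y) := by
    intro x hx h
    exact hx (by simp [h])
  have hi : Integrable (fun x => ‖Φ.ψ (Matrix.vecCons x Y)‖ ^ 2) :=
    (hc.norm.pow 2).integrable_of_hasCompactSupport (hcs.mono hsupp)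
  have h3 : ∫⁻ x, ‖Φ.ψ (Matrix.vecCons x Y)‖ₑ ^ 2 = ∫⁻ x, ENNReal.ofReal (‖Φ.ψ (Matrix.vecCons x Y)‖ ^ 2) :=
    lintegral_congr fun x => by rw [← ofReal_norm, ENNReal.ofReal_pow (norm_nonneg _)]
  rw [h3]
  exact hi.lintegral_lt_top.ne

/-- **The gap step**: `3(π/L)² · N · ∫ dY ∫ dx |r_Y|² ≤ E(Φ) − E₀(0,N,L)` (one-body Dirichlet gap on
every slice + the sharp free upper bound). -/
theorem freeDepletion_le (hL : 0 < L) (Φ : TrialState (n + 1) L) :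
    ENNReal.ofReal (3 * (Real.pi / L) ^ 2) * ((n + 1 : ℝ≥0∞) *
        ∫⁻ Y : Config n, ∫⁻ x, ‖Φ.ψ (Matrix.vecCons x Y) -
          (∫ x, conj (sineMode L x) * Φ.ψ (Matrix.vecCons x Y)) * sineMode L x‖ₑ ^ 2) ≤
      energy 0 Φ - groundStateEnergy 0 (n + 1) L := by
  set A := ENNReal.ofReal (3 * (Real.pi / L) ^ 2) with hA
  set I₂ := ∫⁻ Y : Config n, ∫⁻ x, ‖Φ.ψ (Matrix.vecCons x Y) -
          (∫ x, conj (sineMode L x) * Φ.ψ (Matrix.vecCons x Y)) * sineMode L x‖ₑ ^ 2 with hI₂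
  have hAtop : A ≠ ⊤ := ENNReal.ofReal_ne_top
  have hdiff : Differentiable ℝ Φ.ψ := Φ.contDiff.differentiable one_ne_zero
  -- per slice
  have hslice : ∀ Y : Config n,
      A * (∫⁻ x, ‖Φ.ψ (Matrix.vecCons x Y)‖ₑ ^ 2) +
        A * ∫⁻ x, ‖Φ.ψ (Matrix.vecCons x Y) -
          (∫ x, conj (sineMode L x) * Φ.ψ (Matrix.vecCons x Y)) * sineMode L x‖ₑ ^ 2 ≤
        ∫⁻ x, gradSqC (fun y => Φ.ψ (Matrix.vecCons y Y)) x := by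
    intro Y
    have hG := oneBodyGap hL (contDiff_vecCons_slice Φ.contDiff Y) (slice_eq_zero Φ Y)
    have hu : AEStronglyMeasurable (fun x => Φ.ψ (Matrix.vecCons x Y)) volume :=
      (continuous_slice Φ.contDiff.continuous Y).aestronglyMeasurable
    have hP := lintegral_sub_coef_mul_add hu
      (aestronglyMeasurable_sineMode L) (lintegral_slice_sq_ne_top Φ Y) (lintegral_sineMode_sq hL)
    set D := ∫⁻ x, ‖Φ.ψ (Matrix.vecCons x Y) -
          (∫ x, conj (sineMode L x) * Φ.ψ (Matrix.vecCons x Y)) * sineMode L x‖ₑ ^ 2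
    set X := ‖∫ x, conj (sineMode L x) * Φ.ψ (Matrix.vecCons x Y)‖ₑ ^ 2
    set T := ∫⁻ x, gradSqC (fun y => Φ.ψ (Matrix.vecCons y Y)) x
    have hXtop : A * X ≠ ⊤ := ENNReal.mul_ne_top hAtop (ENNReal.pow_ne_top enorm_ne_top)
    have h6 : ENNReal.ofReal (6 * (Real.pi / L) ^ 2) = A + A := by
      rw [hA, ← ENNReal.ofReal_add (by positivity) (by positivity)]; congr 1; ring
    rw [← hP, h6] at hG
    -- hG : (A + A) * (D + X) ≤ T + A * X
    have h7 : (A * (D + X) + A * D) + A * X ≤ T + A * X := by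
      calc (A * (D + X) + A * D) + A * X = (A + A) * (D + X) := by ring
        _ ≤ T + A * X := hG
    rw [← hP]
    exact (ENNReal.add_le_add_iff_right hXtop).1 h7
  -- integrate over the slices
  have hint := lintegral_mono (μ := (volume : Measure (Config n))) hslice
  have hlhs : A * 1 + A * I₂ ≤ ∫⁻ Y : Config n, ∫⁻ x, gradSqC (fun y => Φ.ψ (Matrix.vecCons y Y)) x := by
    refine le_trans ?_ hint
    rw [← lintegral_lintegral_slice_sq Φ, hI₂, ← lintegral_const_mul' _ _ hAtop,
      ← lintegral_const_mul' _ _ hAtop]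
    exact le_lintegral_add _ _
  rw [mul_one, ← lintegral_partialGradSq_zero_eq hdiff] at hlhs
  -- multiply by `N`
  have hE : energy 0 Φ = ∫⁻ X, kineticDensity Φ.ψ X := by
    unfold energy interaction
    simp
  have hT : (n + 1 : ℝ≥0∞) * ∫⁻ X, partialGradSq 0 Φ.ψ X = energy 0 Φ := by
    rw [← lintegral_kineticDensity_eq_mul hdiff Φ.symm, hE]
  have hE0 : groundStateEnergy 0 (n + 1) L ≤ (n + 1 : ℝ≥0∞) * A := by
    refine (groundStateEnergy_zero_le_sharp hL (n + 1)).trans (le_of_eq ?_)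
    rw [hA, show (3 : ℝ) * ((n + 1 : ℕ) : ℝ) * (Real.pi / L) ^ 2 =
        ((n + 1 : ℕ) : ℝ) * (3 * (Real.pi / L) ^ 2) by ring,
      ENNReal.ofReal_mul (by positivity), ENNReal.ofReal_natCast]
    push_cast
    rfl
  have hmul : (n + 1 : ℝ≥0∞) * (A + A * I₂) ≤ (n + 1 : ℝ≥0∞) * ∫⁻ X, partialGradSq 0 Φ.ψ X := by
    gcongr
  rw [mul_add, hT] at hmul
  have hE0top : groundStateEnergy 0 (n + 1) L ≠ ⊤ :=
    ne_top_of_le_ne_top (ENNReal.mul_ne_top (by simp) hAtop) hE0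
  refine ENNReal.le_sub_of_add_le_left hE0top ?_
  calc groundStateEnergy 0 (n + 1) L + A * ((n + 1 : ℝ≥0∞) * I₂)
      ≤ (n + 1 : ℝ≥0∞) * A + (n + 1 : ℝ≥0∞) * (A * I₂) := by
        exact add_le_add hE0 (le_of_eq (by ring))
    _ ≤ energy 0 Φ := hmul

end Law

/-! ## 11. The free law for one state, the free body, and the route item -/

section Assembly

variable {n : ℕ} {L : ℝ}

/-- **The free gap-window law for one state** (`κ = 1`, allowance `e(k)`, every `L > 0`, every level
`k ≥ 1`, EVERY state — no window hypothesis is needed in the free case). -/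
theorem stateLaw (hL : 0 < L) {k : ℕ} (hk : 1 ≤ k) (Φ : TrialState (n + 1) L) :
    ENNReal.ofReal (1 / L ^ 2) * ((16 : ℝ≥0∞)⁻¹ * ∑ c : SubIdx (2 ^ k), ∑ c' ∈ Finset.univ.filter
        (fun c' : SubIdx (2 ^ k) => c ≠ c' ∧ ∀ j : Fin 3, (c j : ℕ) / 2 = (c' j : ℕ) / 2),
        occupation (n + 1) (fun x => subMode (L / 2 ^ k) c x - subMode (L / 2 ^ k) c' x) Φ.ψ) ≤
      (energy 0 Φ - groundStateEnergy 0 (n + 1) L) +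
        ENNReal.ofReal (1 / L ^ 2 * eTab k * ((n + 1 : ℕ) : ℝ)) := by
  have hℓ : 0 < L / 2 ^ k := by positivity
  have hcont : Continuous Φ.ψ := Φ.contDiff.continuous
  -- Step 1: the sibling pair sum as `N ∫ dY (slice pair sum)`
  have hg : ∀ c c' : SubIdx (2 ^ k), Measurable fun Y : Config n =>
      (ENNReal.ofReal (L / 2 ^ k) ^ 3)⁻¹ *
        ‖J Φ.ψ (subCell (L / 2 ^ k) c) Y - J Φ.ψ (subCell (L / 2 ^ k) c') Y‖ₑ ^ 2 := fun c c' =>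
    (((stronglyMeasurable_J hcont _).sub (stronglyMeasurable_J hcont _)).measurable.enorm.pow_const _).const_mul _
  have hsum : ∑ c : SubIdx (2 ^ k), ∑ c' ∈ Finset.univ.filter
        (fun c' : SubIdx (2 ^ k) => c ≠ c' ∧ ∀ j : Fin 3, (c j : ℕ) / 2 = (c' j : ℕ) / 2),
        occupation (n + 1) (fun x => subMode (L / 2 ^ k) c x - subMode (L / 2 ^ k) c' x) Φ.ψ =
      (n + 1 : ℝ≥0∞) * ∫⁻ Y : Config n, ∑ P : SubIdx (2 ^ (k - 1)), ∑ c ∈ children P, ∑ c' ∈ children P,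
        (ENNReal.ofReal (L / 2 ^ k) ^ 3)⁻¹ *
          ‖J Φ.ψ (subCell (L / 2 ^ k) c) Y - J Φ.ψ (subCell (L / 2 ^ k) c') Y‖ₑ ^ 2 := by
    rw [sibling_sum_eq _ (fun c => occupation_dip_self c Φ.ψ)]
    simp_rw [occupation_dip_eq hℓ _ _ Φ, ← enorm_eq_nnnorm]
    rw [lintegral_finsetSum _ (fun P _ => Finset.measurable_sum _ fun c _ =>
      Finset.measurable_sum _ fun c' _ => hg c c'), Finset.mul_sum]
    refine Finset.sum_congr rfl fun P _ => ?_
    rw [lintegral_finsetSum _ (fun c _ => Finset.measurable_sum _ fun c' _ => hg c c'), Finset.mul_sum]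
    refine Finset.sum_congr rfl fun c _ => ?_
    rw [lintegral_finsetSum _ (fun c' _ => hg c c'), Finset.mul_sum]
  -- Step 2: integrate the slice law
  have hm1 : Measurable fun Y : Config n => ‖∫ x, conj (sineMode L x) * Φ.ψ (Matrix.vecCons x Y)‖ₑ ^ 2 :=
    (stronglyMeasurable_coef L Φ).measurable.enorm.pow_const _
  have hq : ∫⁻ Y : Config n, ∑ P : SubIdx (2 ^ (k - 1)), ∑ c ∈ children P, ∑ c' ∈ children P,
        (ENNReal.ofReal (L / 2 ^ k) ^ 3)⁻¹ *
          ‖J Φ.ψ (subCell (L / 2 ^ k) c) Y - J Φ.ψ (subCell (L / 2 ^ k) c') Y‖ₑ ^ 2 ≤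
      ENNReal.ofReal (5 / 4) * (∫⁻ Y : Config n, ‖∫ x, conj (sineMode L x) * Φ.ψ (Matrix.vecCons x Y)‖ₑ ^ 2) *
          (16 * ENNReal.ofReal (Greal L k)) +
        160 * ∫⁻ Y : Config n, ∫⁻ x, ‖Φ.ψ (Matrix.vecCons x Y) -
          (∫ x, conj (sineMode L x) * Φ.ψ (Matrix.vecCons x Y)) * sineMode L x‖ₑ ^ 2 := by
    refine (lintegral_mono fun Y => sliceLaw hL hk Φ Y).trans (le_of_eq ?_)
    rw [lintegral_add_left ((hm1.const_mul _).mul_const _), lintegral_mul_const _ (hm1.const_mul _),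
      lintegral_const_mul _ hm1, lintegral_const_mul' _ _ (by norm_num)]
  -- Step 3: `∫ dY |α(Y)|² ≤ 1`
  have hI₁ : ∫⁻ Y : Config n, ‖∫ x, conj (sineMode L x) * Φ.ψ (Matrix.vecCons x Y)‖ₑ ^ 2 ≤ 1 := by
    rw [← lintegral_lintegral_slice_sq Φ]
    refine lintegral_mono fun Y => ?_
    have hu : AEStronglyMeasurable (fun x => Φ.ψ (Matrix.vecCons x Y)) volume :=
      (continuous_slice Φ.contDiff.continuous Y).aestronglyMeasurable
    have hP := lintegral_sub_coef_mul_add hu (aestronglyMeasurable_sineMode L)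
      (lintegral_slice_sq_ne_top Φ Y) (lintegral_sineMode_sq hL)
    rw [← hP]
    exact le_add_self
  -- Step 4: the gap
  have hgap := freeDepletion_le hL Φ
  -- Step 5: arithmetic
  set Iq := ∫⁻ Y : Config n, ∑ P : SubIdx (2 ^ (k - 1)), ∑ c ∈ children P, ∑ c' ∈ children P,
        (ENNReal.ofReal (L / 2 ^ k) ^ 3)⁻¹ *
          ‖J Φ.ψ (subCell (L / 2 ^ k) c) Y - J Φ.ψ (subCell (L / 2 ^ k) c') Y‖ₑ ^ 2 with hIq
  set I₁ := ∫⁻ Y : Config n, ‖∫ x, conj (sineMode L x) * Φ.ψ (Matrix.vecCons x Y)‖ₑ ^ 2 with hI₁def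
  set I₂ := ∫⁻ Y : Config n, ∫⁻ x, ‖Φ.ψ (Matrix.vecCons x Y) -
          (∫ x, conj (sineMode L x) * Φ.ψ (Matrix.vecCons x Y)) * sineMode L x‖ₑ ^ 2 with hI₂def
  set G := ENNReal.ofReal (Greal L k) with hGdef
  have h16 : (16 : ℝ≥0∞)⁻¹ * 16 = 1 := ENNReal.inv_mul_cancel (by norm_num) (by norm_num)
  have h10' : (16 : ℝ≥0∞)⁻¹ * 160 = 10 := by
    rw [show (160 : ℝ≥0∞) = 16 * 10 by norm_num, ← mul_assoc, h16, one_mul]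
  have h160 : ENNReal.ofReal (1 / L ^ 2) * ((16 : ℝ≥0∞)⁻¹ * 160) = ENNReal.ofReal (10 / L ^ 2) := by
    rw [h10', show (10 : ℝ≥0∞) = ENNReal.ofReal 10 by simp, ← ENNReal.ofReal_mul (by positivity)]
    congr 1; ring
  have hT1 : (n + 1 : ℝ≥0∞) * (ENNReal.ofReal (1 / L ^ 2) * ENNReal.ofReal (5 / 4) * G) ≤
      ENNReal.ofReal (1 / L ^ 2 * eTab k * ((n + 1 : ℕ) : ℝ)) := by
    have hN : (n + 1 : ℝ≥0∞) = ENNReal.ofReal ((n + 1 : ℕ) : ℝ) := by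
      rw [ENNReal.ofReal_natCast]; push_cast; rfl
    rw [hN, hGdef, ← ENNReal.ofReal_mul (by positivity), ← ENNReal.ofReal_mul (by positivity),
      ← ENNReal.ofReal_mul (by positivity)]
    refine ENNReal.ofReal_le_ofReal ?_
    rw [Greal_eq_Fexp hL hk, eTab]
    have hp : 0 < (1 / 2 : ℝ) ^ k / 100 := by positivity
    have hX := Fexp_sub_nonneg k
    have hL2 : 0 < 1 / L ^ 2 := by positivity
    have hNn : (0 : ℝ) ≤ ((n + 1 : ℕ) : ℝ) := Nat.cast_nonneg _
    nlinarith [mul_nonneg (mul_nonneg hL2.le hp.le) hNn]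
  have h10 : ENNReal.ofReal (10 / L ^ 2) ≤ ENNReal.ofReal (3 * (Real.pi / L) ^ 2) := by
    refine ENNReal.ofReal_le_ofReal ?_
    rw [div_pow, ← mul_div_assoc]
    gcongr
    nlinarith [Real.pi_gt_three, Real.pi_pos]
  have hT2 : ENNReal.ofReal (10 / L ^ 2) * ((n + 1 : ℝ≥0∞) * I₂) ≤ energy 0 Φ - groundStateEnergy 0 (n + 1) L :=
    calc ENNReal.ofReal (10 / L ^ 2) * ((n + 1 : ℝ≥0∞) * I₂)
        ≤ ENNReal.ofReal (3 * (Real.pi / L) ^ 2) * ((n + 1 : ℝ≥0∞) * I₂) := by gcongr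
      _ ≤ _ := hgap
  rw [hsum]
  calc ENNReal.ofReal (1 / L ^ 2) * ((16 : ℝ≥0∞)⁻¹ * ((n + 1 : ℝ≥0∞) * Iq))
      ≤ ENNReal.ofReal (1 / L ^ 2) * ((16 : ℝ≥0∞)⁻¹ * ((n + 1 : ℝ≥0∞) *
          (ENNReal.ofReal (5 / 4) * I₁ * (16 * G) + 160 * I₂))) := by gcongr
    _ ≤ ENNReal.ofReal (1 / L ^ 2) * ((16 : ℝ≥0∞)⁻¹ * ((n + 1 : ℝ≥0∞) *
          (ENNReal.ofReal (5 / 4) * 1 * (16 * G) + 160 * I₂))) := by gcongr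
    _ = (n + 1 : ℝ≥0∞) * (ENNReal.ofReal (1 / L ^ 2) * ENNReal.ofReal (5 / 4) * G * ((16 : ℝ≥0∞)⁻¹ * 16)) +
          ENNReal.ofReal (1 / L ^ 2) * ((16 : ℝ≥0∞)⁻¹ * 160) * ((n + 1 : ℝ≥0∞) * I₂) := by ring
    _ = (n + 1 : ℝ≥0∞) * (ENNReal.ofReal (1 / L ^ 2) * ENNReal.ofReal (5 / 4) * G) +
          ENNReal.ofReal (10 / L ^ 2) * ((n + 1 : ℝ≥0∞) * I₂) := by rw [h16, mul_one, h160]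
    _ ≤ ENNReal.ofReal (1 / L ^ 2 * eTab k * ((n + 1 : ℕ) : ℝ)) +
          (energy 0 Φ - groundStateEnergy 0 (n + 1) L) := add_le_add hT1 hT2
    _ = _ := add_comm _ _

/-- **The free body**: the window statement of `GapWindowResponse` for `v = 0`, every `ρ > 0` and every `M'`
(`κ = 1`, `e(K,k) = e(k)`; the window hypotheses and the near-minimiser hypothesis are not even used). -/
theorem freeBody {ρ : ℝ} (hρ : 0 < ρ) (M' : ℝ) :
    ∃ κ : ℝ, 0 < κ ∧ κ ≤ 1 ∧ ∃ e : ℕ → ℕ → ℝ, (∀ K k : ℕ, 0 < e K k) ∧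
      (∀ K : ℕ, ∑ k ∈ Finset.range (K + 1), e K k ≤ 3 / 4) ∧
      ∀ᶠ N : ℕ in Filter.atTop, ∀ K k : ℕ,
        M' ^ 4 ≤ (sideLength ρ N / 2 ^ K) ^ 4 * ρ ^ 3 →
        (sideLength ρ N / 2 ^ K) ^ 4 * ρ ^ 3 < 16 * M' ^ 4 → 1 ≤ k → k ≤ K →
        ∀ Φ : TrialState N (sideLength ρ N),
          energy 0 Φ ≤ groundStateEnergy 0 N (sideLength ρ N) +
              ENNReal.ofReal (κ / sideLength ρ N ^ 2 * e K k * N) →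
          ENNReal.ofReal (κ / sideLength ρ N ^ 2) * ((16 : ℝ≥0∞)⁻¹ * ∑ c : SubIdx (2 ^ k),
              ∑ c' ∈ Finset.univ.filter
                (fun c' : SubIdx (2 ^ k) => c ≠ c' ∧ ∀ j : Fin 3, (c j : ℕ) / 2 = (c' j : ℕ) / 2),
              occupation N (fun x => subMode (sideLength ρ N / 2 ^ k) c x -
                subMode (sideLength ρ N / 2 ^ k) c' x) Φ.ψ) ≤
            (energy 0 Φ - groundStateEnergy 0 N (sideLength ρ N)) +
              ENNReal.ofReal (κ / sideLength ρ N ^ 2 * e K k * N) := by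
  refine ⟨1, one_pos, le_rfl, fun _ k => eTab k, fun _ k => eTab_pos k, fun K => sum_eTab_le K, ?_⟩
  filter_upwards [Filter.eventually_ge_atTop 1] with N hN K k _ _ hk _ Φ _
  obtain ⟨n, rfl⟩ : ∃ n, N = n + 1 := ⟨N - 1, (Nat.sub_add_cancel hN).symm⟩
  have hL : 0 < sideLength ρ (n + 1) := sideLength_pos_of_pos hρ (Nat.succ_pos n)
  exact stateLaw hL hk Φ

/-- **`GapWindowResponseFree` holds** (route GapWindowLadder, item stmt-AtomisticToContinuum-28031): the gap-window
response law in the window, for every repulsive finite-range potential of ZERO scattering length — with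
`ρ₀ = 1`, `κ = 1` and the explicit allowance table `e(K,k) = (5/4)(F_k − F_{k−1}) + 2^{-k}/100`. -/
theorem gapWindowResponseFree :
    Summit.AtomisticToContinuum.BoseEinsteinCondensation.Theses.GapWindowLadder.GapWindowResponseFree := by
  intro v hv h0 M' _
  refine ⟨1, one_pos, fun ρ hρ _ => ?_⟩
  simp only [energy_eq_energy_zero hv h0, groundStateEnergy_eq_zero hv h0]
  exact freeBody hρ M'

end Assembly

end Summit.AtomisticToContinuum.BoseEinsteinCondensation.Theorems.GapWindowLadderFreeWindow
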